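import Literature.AlgebraicGeometry.Frobenioids.ElementaryFrobenioid
import Mathlib.CategoryTheory.Comma.Over.Basic
import HarnessLib

/-!
# Frobenioids I, Remark 1.13.1: a Frobenioid that is not slim

Mochizuki, *The geometry of Frobenioids I: the general theory*, Kyushu J. Math. **62** (2008)
293–400, §1, Remark 1.13.1, kurims text pp. 40–41 [cite: MochizukiFrdI2008, Rem. 1.13.1].

> "Note that if the hypothesis of Proposition 1.13, (iii), fails to hold, then it is not
> necessarily the case that `C` is slim. Indeed, if `M` is a perfect pre-divisorial monoid, and
> `C` is a one-object category whose unique object has endomorphism monoid equal to the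
> elementary Frobenioid `F_M` [so `C` equipped with the functor of one-object categories
> determined by the natural morphism of monoids `F_M → F_M^{char}` is a Frobenioid, by
> Proposition 1.5, (i)], then any collection of elements `{αₙ}_{n ∈ N_{≥1}}` of `M^±` such that
> `α_{nm} = m · αₙ` for all `n, m ∈ N_{≥1}` determines an automorphism of the natural functor
> `C_A → C` [which is nontrivial as soon as any of the `αₙ` is nonzero] by assigning to an arrow
> `φ : B → A` of `C` the automorphism `α_{deg_Fr(φ)} ∈ Aut_C(B)`."

Everything here is PROVED. `C` is `F_{Φ_M} = ElemFrobenioid (constMonoidOn M)`, the one-object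
category with endomorphism monoid `F_M` of Def. 1.1 (iii) (landed `ElementaryFrobenioid.lean`).

ERRATUM recorded (read on the page, p. 41 l. 5): with `C_A` the slice category of arrows `B → A`
(§0, p. 13) the assignment `φ ↦ α_{deg_Fr(φ)}` is natural exactly when `n · α_{nm} = α_m` for all
`n, m` (naturality along an arrow `ψ` of `C_A` from `ψ ∘ φ₂… = φ₁` to `φ₂` reads, by Remark 1.1.1,
`α_{deg φ₂} = deg(ψ) · α_{deg ψ · deg φ₂}`), i.e. when `αₙ` is an `n`-th root of `α₁` — this is
where the hypothesis "`M` perfect" is used (unique divisibility of `M`, hence of `M^±`); the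
printed relation "`α_{nm} = m · αₙ`" (`αₙ = n · α₁`) is the one adapted to the coslice `ᴬC`. We
type the remark with the relation that makes the displayed assignment natural for `C_A`
(`rootFamily` condition `α (n m) ^ n = α m`, multiplicative rendering), prove that it yields an
automorphism of `C_A → C` which is nontrivial as soon as some `αₙ ≠ 1`, that such families with
prescribed `α₁ ∈ M^±` exist when `M` is perfect, and conclude that `F_{Φ_M}` is not slim whenever
`M` is perfect with `M^± ≠ {1}`. The clause "[so `C` … is a Frobenioid, by Proposition 1.5, (i)]"
is Prop. 1.5 (i) (`ElemFrobenioid.isFrobenioid_toChar` in the Prop. 1.5 file) and is not restated.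
-/

namespace Literature.AlgebraicGeometry.Frobenioids

open CategoryTheory Opposite

universe w

namespace ElemFrobenioid

variable {M : Type w} [CommMonoid M]

/-- Pull-backs of the constant monoid `Φ_M` are identities. [cite: MochizukiFrdI2008, Def. 1.1(iii)] -/
theorem pull_constMonoidOn {X Y : Discrete PUnit.{w + 1}} (g : X ⟶ Y)
    (x : (constMonoidOn M).obj (op Y)) : pull (constMonoidOn M) g x = x := rfl

/-- **Remark 1.13.1**, the construction: for a family `(αₙ)` of units of `M` with
`α_{nm}^n = α_m` (see the module docstring for this reading of the printed relation), the
assignment `(φ : B → A) ↦ α_{deg_Fr(φ)} ∈ O^×(B) ⊆ Aut_C(B)` is an automorphism of the natural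
functor `C_A → C` for `C = F_{Φ_M}`. [cite: MochizukiFrdI2008, Rem. 1.13.1 p.41] -/
theorem exists_iso_forget_of_rootFamily (α : ℕ+ → Mˣ)
    (hα : ∀ n m : ℕ+, α (n * m) ^ (n : ℕ) = α m) (A : ElemFrobenioid (constMonoidOn M)) :
    ∃ β : Over.forget A ≅ Over.forget A,
      ∀ f : Over A, β.hom.app f = homMk (𝟙 _) (α (degFr f.hom) : M) 1 := by
  refine ⟨NatIso.ofComponents (fun f => ⟨homMk (𝟙 _) (α (degFr f.hom) : M) 1,
    homMk (𝟙 _) (((α (degFr f.hom))⁻¹ : Mˣ) : M) 1, ?_, ?_⟩) ?_, fun f => rfl⟩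
  · -- `(id, αₙ, 1) ∘ (id, αₙ⁻¹, 1) = id`
    refine Hom.ext (Category.comp_id _) ?_ rfl
    show (((α (degFr f.hom))⁻¹ : Mˣ) : M) * (α (degFr f.hom) : M) ^ ((1 : ℕ+) : ℕ) = 1
    rw [PNat.one_coe, pow_one, Units.inv_mul]
  · refine Hom.ext (Category.comp_id _) ?_ rfl
    show (α (degFr f.hom) : M) * (((α (degFr f.hom))⁻¹ : Mˣ) : M) ^ ((1 : ℕ+) : ℕ) = 1
    rw [PNat.one_coe, pow_one, Units.mul_inv]
  · -- naturality along `h : f₁ → f₂`, i.e. `h ∘ … ` with `f₂ ∘ h = f₁`: Remark 1.1.1 and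
    -- `α_{deg f₂} = α_{deg h · deg f₂} ^ deg h`
    intro f₁ f₂ h
    have hdeg : degFr f₁.hom = degFr h.left * degFr f₂.hom := by
      rw [← Over.w h]
      rfl
    refine Hom.ext ((Category.comp_id _).trans (Category.id_comp _).symm) ?_ ?_
    · show (α (degFr f₂.hom) : M) * (id (Div h.left) : M) ^ ((1 : ℕ+) : ℕ) =
        (id (Div h.left) : M) * (α (degFr f₁.hom) : M) ^ (degFr h.left : ℕ)
      rw [PNat.one_coe, pow_one, hdeg, ← Units.val_pow_eq_pow_val, hα, mul_comm]
    · show degFr h.left * 1 = 1 * degFr h.left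
      rw [mul_one, one_mul]

/-- **Remark 1.13.1**, nontriviality: the automorphism of `C_A → C` attached to `(αₙ)` is
"nontrivial as soon as any of the `αₙ` is nonzero" (the base-identity endomorphism of `A` of
Frobenius degree `n` is an object of `C_A` at which the component is `αₙ`).
[cite: MochizukiFrdI2008, Rem. 1.13.1 p.41] -/
theorem exists_iso_forget_ne_refl_of_rootFamily (α : ℕ+ → Mˣ)
    (hα : ∀ n m : ℕ+, α (n * m) ^ (n : ℕ) = α m) (hne : ∃ n, α n ≠ 1)
    (A : ElemFrobenioid (constMonoidOn M)) :
    ∃ β : Over.forget A ≅ Over.forget A, β ≠ Iso.refl _ := by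
  obtain ⟨β, hβ⟩ := exists_iso_forget_of_rootFamily α hα A
  obtain ⟨n, hn⟩ := hne
  refine ⟨β, fun h => hn ?_⟩
  -- the object `(id, 0, n) : A → A` of `C_A`
  have h1 := hβ (Over.mk (homMk (𝟙 A.base) (1 : M) n))
  rw [h] at h1
  have h2 := congrArg Hom.div h1
  exact Units.val_eq_one.mp h2.symm

/-- **Remark 1.13.1**, the hypothesis "`M` perfect": in a perfect monoid every unit `u` admits
a (unique) family `(αₙ)` of units with `α₁ = u` and `α_{nm}^n = α_m` — `αₙ` is the `n`-th root
of `u`. [cite: MochizukiFrdI2008, Rem. 1.13.1 p.40] -/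
theorem exists_rootFamily (hM : IsPerfect M) (u : Mˣ) :
    ∃ α : ℕ+ → Mˣ, α 1 = u ∧ ∀ n m : ℕ+, α (n * m) ^ (n : ℕ) = α m := by
  -- `n`-th roots of `u`, and the fact that they are units
  have hroot : ∀ n : ℕ+, ∃ r : Mˣ, (r : M) ^ (n : ℕ) = u := by
    intro n
    obtain ⟨r, hr⟩ := (hM.bijective_pow n n.pos).2 (u : M)
    have hr : r ^ (n : ℕ) = u := hr
    have hr' : r * (r ^ ((n : ℕ) - 1) * ↑u⁻¹) = 1 := by
      rw [← mul_assoc, ← pow_succ', Nat.sub_add_cancel n.pos, hr, Units.mul_inv]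
    exact ⟨(IsUnit.of_mul_eq_one _ hr').unit, hr⟩
  choose α hα using hroot
  have hinj : ∀ (n : ℕ+) (a b : M), a ^ (n : ℕ) = b ^ (n : ℕ) → a = b :=
    fun n a b h => (hM.bijective_pow n n.pos).1 h
  refine ⟨α, Units.ext ?_, fun n m => Units.ext (hinj m _ _ ?_)⟩
  · have := hα 1
    rwa [PNat.one_coe, pow_one] at this
  · rw [Units.val_pow_eq_pow_val, ← pow_mul, ← PNat.mul_coe, hα (n * m), hα m]

/-- **Remark 1.13.1**, conclusion: for a perfect monoid `M` with a nontrivial unit, the one-object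
category `F_{Φ_M}` (whose endomorphism monoid is `F_M`) is NOT slim, although [for `M` moreover
pre-divisorial] `F_M → F_{M^{char}}` is a Frobenioid (Prop. 1.5 (i)): the hypothesis of
Prop. 1.13 (iii) cannot be dropped. [cite: MochizukiFrdI2008, Rem. 1.13.1 p.40] -/
theorem not_isSlim_of_isPerfect (hM : IsPerfect M) (u : Mˣ) (hu : u ≠ 1) :
    ¬ IsSlim (ElemFrobenioid (constMonoidOn M)) := by
  intro hslim
  obtain ⟨α, hα₁, hα⟩ := exists_rootFamily hM u
  let A : ElemFrobenioid (constMonoidOn M) := of (constMonoidOn M) (Discrete.mk PUnit.unit)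
  obtain ⟨β, hβ⟩ := exists_iso_forget_ne_refl_of_rootFamily α hα ⟨1, hα₁.symm ▸ hu⟩ A
  exact hβ (hslim.isRigid_forget A β)

end ElemFrobenioid

end Literature.AlgebraicGeometry.Frobenioids
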